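import Literature.MathematicalPhysics.QuantumFieldTheory.Balaban1983to89.T4TwoRunUniqueness
import Summits.QuantumFields.BalabanUV.Gaps.CapSignsNecessaryFine

/-!
# Gaps / CapSignsNecessaryFwd — the necessity series ON THE DATUM: forward generation ALONE carries the lower direction ((N1), (N2), the iff's,
# the convergence floor), and forward generation + the printed upper bound (U) carries the upper direction (the sandwich) — no `HaltsOutside`,
# no `CurriesHBeta` (cell pub-balaban-gaps, seat g1-p3 gen 3; §1, §3's plumbing and §4 ADOPTED from g1-plan-2 GEN 8's XREAD kernels
# `g1/skeletons/XreadFwdOnlyNecessity_plan2.lean` fad218978fb91e7e (X-43) and `g1/skeletons/XreadFwdU_plan2.lean` 094c331861237bd7 (X-51), filed on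
# the planner's «p3's pen» disposition)

HONEST FRAMING (cell rule, page 1 of everything): bookkeeping over the β sub-cell's hypothesis carriers; NOTHING of Bałaban's is asserted beyond
print; [Balaban1987RG1] Thm 2 is UNPROVED IN PRINT and is the HYPOTHESIS `B12.Thm2Printed C L` throughout; 0 binders discharged; NOT `BetaPertH`,
NOT the continuum limit, NOT Clay.  HONEST DEPENDENCY (b2b cell, verbatim): «continuum YM on T⁴ ⇐ BetaPertH ∧ nine spine estimates (0/9 proved);
BetaPertH ⇐ (D1) ∧ (D4) ∧ CAP+tail; G-an2-4 gates asym, D1 and NE2/3/4.»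

WHY (g1-plan-2 X-43 ∕ X-51).  `CapSignsNecessary` §1 obtains the realised window IDENTITY from `RGEqH` via `FlowStepRuns.rgEqH_of_inInterval hgen
hhalt hcur`, so the series carries `(hhalt : HaltsOutside C β) (hcur : CurriesHBeta C β)`.  The datum `T4Continuum.FiniteEpsData` has the fields
`fwd` (and `curries`) but NO halting field, so as landed the series does not instantiate at `(D.C.toB12, D.βfun)`.  It need not: (i) forward
generation ALONE gives the realised window sum as an INEQUALITY `1/g_k² − 1/g_n² ≤ Σ_{j∈[k,n)} β_j(g_0,…,g_j)` along in-interval runs (at an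
unsolvable step `β_j(prefix) ≥ 1/g_j² > 1/g_j² − 1/g_{j+1}²`), which is all the LOWER direction consumes; (ii) for the UPPER direction the
identity comes from forward generation + (U) `BetaUpperH β′ γ β` with `γ²β′ < 1` by the tree's `T4TwoRunUniqueness.rgEqH_of_forwardGenerated`.
§1 `windowSum_ge_of_forwardGenerated`, `step_ge_of_forwardGenerated` (X-43 kernel).  §2 `exists_boxPoint_ge_of_thm2Printed_fwd`, (N1)
`beta0_nonneg_of_thm2Printed_fwd` (+ `_closedBox` ∕ `_everySlope` ∕ `_limitForm`), the negative socket `not_thm2Printed_of_beta0_neg_fwd`.  §3 (N2)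
`beta0_windowSum_ge_of_ineqRun` (X-43 kernel), `beta0_windowSum_lower_of_thm2Printed_fwd`, `not_thm2Printed_of_abelian_fwd`,
`eventualFloor_of_thm2Printed_tendsto_fwd`, the iff's `thm2Printed_iff_signs_of_limitForm_fwd` ∕ `thm2Printed_iff_allSigns_and_limit_pos_fwd`
(hypothesis-symmetric: `hgen` only on both sides).  §4 (X-51 kernel) `runs_of_thm2Printed_fwdU` — the runs package WITH the recursion from
`ForwardGenerated` + (U); `thm2Printed_constants_sandwich_fwdU`.  §5 ON THE DATUM `D : T4Continuum.FiniteEpsData F G`: `beta0_nonneg_of_thm2Printed_datum`,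
`beta0_windowSum_lower_of_thm2Printed_datum`, `thm2Printed_constants_sandwich_datum` (with `hgen := D.fwd`; (U) on a box for the sandwich).
All [folklore]; 0 sorry; 0 def; imports `Gaps.CapSignsNecessaryFine` (→ the series) + `Literature.…T4TwoRunUniqueness`; restates nothing.
-/

namespace Summit.QuantumFields.BalabanUV.Gaps.CapSignsNecessaryFwd

open Literature.MathematicalPhysics.QuantumFieldTheory.Balaban1983to89
open Literature.MathematicalPhysics.QuantumFieldTheory.Balaban1983to89.FlowStep
open Literature.MathematicalPhysics.QuantumFieldTheory.Balaban1983to89.FlowStepRuns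
open Literature.MathematicalPhysics.QuantumFieldTheory.Balaban1983to89.DagBinding
open Literature.MathematicalPhysics.QuantumFieldTheory.Balaban1983to89.Beta.RemainderChain (RemainderConst)
open Summit.QuantumFields.BalabanUV.Gaps.CapSignsConstRoad (EverySlope everySlope_of_af1)
open Summit.QuantumFields.BalabanUV.Gaps.CapSignsNecessary
open Summit.QuantumFields.BalabanUV.Gaps.CapTailLimitNecessary
open Summit.QuantumFields.BalabanUV.Gaps.CapTailSlopeSandwich
open Filter
open scoped Topology

noncomputable section

variable {β : HBeta}

/-! ## §1 The realised window INEQUALITY from forward generation alone (g1-plan-2 X-43) -/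

/-- **REALISED WINDOW INEQUALITY FROM FORWARD GENERATION ALONE** (no `HaltsOutside`, no `CurriesHBeta`): along a run of a forward-generated
construction that stays in `]0,γ]` up to `K`, `1/g_k² − 1/g_n² ≤ Σ_{j∈[k,n)} β_j(g_0,…,g_j)` for `k ≤ n ≤ K` (at a step where (0.20) has no
positive solution, `β_j(prefix) ≥ 1/g_j² > 1/g_j² − 1/g_{j+1}²`; at a solvable step equality).  Adopted from g1-plan-2's X-43 kernel. [folklore] -/
theorem windowSum_ge_of_forwardGenerated {C : B12.Construction} (hgen : ForwardGenerated C β)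
    (P : B12.RunParams) {γ : ℝ} (hI : (C P).flow.InInterval γ P.K) {k n : ℕ} (hkn : k ≤ n) (hn : n ≤ P.K) :
    1 / ((C P).flow.g k) ^ 2 - 1 / ((C P).flow.g n) ^ 2 ≤ ∑ j ∈ Finset.Ico k n, β j (prefixOf (C P).flow.g j) := by
  induction n, hkn using Nat.le_induction with
  | base => simp
  | succ n hkn ih =>
    have hnK : n < P.K := Nat.lt_of_succ_le hn
    have ih' := ih hnK.le
    rw [Finset.sum_Ico_succ_top hkn]
    have hpos : ∀ i, i ≤ n → 0 < (C P).flow.g i := fun i hi => (hI i (hi.trans hnK.le)).1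
    have hpos1 : 0 < (C P).flow.g (n + 1) := (hI (n + 1) hn).1
    by_cases hsol : 0 < 1 / ((C P).flow.g n) ^ 2 - β n (prefixOf (C P).flow.g n)
    · have heq := (hgen.2 P n hnK hpos hsol).2
      linarith
    · have hsol' : 1 / ((C P).flow.g n) ^ 2 - β n (prefixOf (C P).flow.g n) ≤ 0 := not_lt.mp hsol
      have h1 : 0 < 1 / ((C P).flow.g (n + 1)) ^ 2 := by positivity
      linarith

/-- The one-step case: at any `k < K`, `1/g_k² − 1/g_{k+1}² ≤ β_k(g_0,…,g_k)`. [folklore] -/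
theorem step_ge_of_forwardGenerated {C : B12.Construction} (hgen : ForwardGenerated C β)
    (P : B12.RunParams) {γ : ℝ} (hI : (C P).flow.InInterval γ P.K) {k : ℕ} (hk : k < P.K) :
    1 / ((C P).flow.g k) ^ 2 - 1 / ((C P).flow.g (k + 1)) ^ 2 ≤ β k (prefixOf (C P).flow.g k) := by
  have h := windowSum_ge_of_forwardGenerated hgen P hI (Nat.le_succ k) hk
  rwa [Finset.sum_Ico_succ_top le_rfl, Finset.Ico_self, Finset.sum_empty, zero_add] at h

/-! ## §2 (N1) with forward generation only -/

/-- §1 of `CapSignsNecessary` WITH `hgen` ONLY: `∀ m ∃ γ₂ > 0 ∀ γ ∈ ]0,γ₂] ∃ β > 0 ∀ k ∃ v ∈ ]0,γ]^{k+1}` with `β·log L ≤ β_{k+1}(v)` — the realised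
history of the lattice `K = k+1`. [cite: Balaban1987RG1, Thm 2 (0.31) p.259] -/
theorem exists_boxPoint_ge_of_thm2Printed_fwd {C : B12.Construction} (hgen : ForwardGenerated C β) {L : ℝ}
    (h : B12.Thm2Printed C L) (m : ℕ) :
    ∃ γ₂ : ℝ, 0 < γ₂ ∧ ∀ γ : ℝ, 0 < γ → γ ≤ γ₂ → ∃ b : ℝ, 0 < b ∧ ∀ k : ℕ, ∃ v ∈ Box γ k, b * Real.log L ≤ β k v := by
  obtain ⟨γ₂, hγ₂, hγ⟩ := h m
  refine ⟨γ₂, hγ₂, fun γ hγ0 hγle => ?_⟩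
  obtain ⟨gstar, hgstar, hg⟩ := hγ γ hγ0 hγle
  obtain ⟨b, β', hb, -, hK⟩ := hg gstar hgstar le_rfl
  refine ⟨b, hb, fun k => ?_⟩
  obtain ⟨g0, hI, hend, hbounds⟩ := hK (k + 1)
  refine ⟨prefixOf (C ⟨k + 1, m, g0⟩).flow.g k, mem_box.mpr fun i => hI i (by omega), ?_⟩
  have hw := step_ge_of_forwardGenerated hgen ⟨k + 1, m, g0⟩ hI (Nat.lt_succ_self k)
  have hl := (hbounds k (Nat.le_succ k)).1
  have hend' : (C ⟨k + 1, m, g0⟩).flow.g (k + 1) = gstar := hend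
  rw [hend'] at hw
  have e : (((k + 1 : ℕ) : ℝ) - k) * Real.log L = Real.log L := by push_cast; ring
  rw [e] at hl
  linarith

/-- **(N1) WITH `hgen` ONLY** — [I] Theorem 2 as printed forces `0 ≤ β⁰_{k+1}` for every `k`, for every FORWARD-GENERATED construction (`L > 1`), as
soon as the remainder of the split is small near the zero history at each scale.  `CapSignsNecessary.beta0_nonneg_of_thm2Printed` minus `hhalt`,
`hcur`. [cite: Balaban1987RG1, Thm 2 (0.31) p.259] -/
theorem beta0_nonneg_of_thm2Printed_fwd {C : B12.Construction} (hgen : ForwardGenerated C β) (S : B12Beta.OneLoopSplit β)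
    (hR : ∀ (k : ℕ) (ε : ℝ), 0 < ε → ∃ γ : ℝ, 0 < γ ∧ ∀ p ∈ B12Beta.HistBox γ k, |S.β1 k p| ≤ ε)
    {L : ℝ} (hL : 1 < L) (h : B12.Thm2Printed C L) (k : ℕ) : 0 ≤ S.β0 k := by
  refine le_of_not_gt fun hneg => ?_
  obtain ⟨γε, hγε, hε⟩ := hR k (-(S.β0 k) / 2) (by linarith)
  obtain ⟨γ₂, hγ₂, hγ⟩ := exists_boxPoint_ge_of_thm2Printed_fwd hgen h 0
  obtain ⟨b, hb, hk⟩ := hγ (min γ₂ γε) (lt_min hγ₂ hγε) (min_le_left _ _)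
  obtain ⟨v, hv, hbv⟩ := hk k
  have hvε : v ∈ B12Beta.HistBox γε k := fun i => ⟨(mem_box.mp hv i).1, (mem_box.mp hv i).2.trans (min_le_right _ _)⟩
  have h1 := (abs_le.mp (hε v hvε)).2
  have hpos : 0 < b * Real.log L := mul_pos hb (Real.log_pos hL)
  rw [S.split k v] at hbv
  linarith

/-- (N1), `hgen` only, with the print-shaped supplier: continuity of `β¹_{k+1}` on the closed boxes `[0,γ]^{k+1}` + printed vanishing. [cite: Balaban1987RG1, Thm 2 (0.31) p.259 and §1 p.264] -/
theorem beta0_nonneg_of_thm2Printed_fwd_closedBox {C : B12.Construction} (hgen : ForwardGenerated C β) (S : B12Beta.OneLoopSplit β)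
    {γ : ℝ} (hγ : 0 < γ) (hcont : ∀ k, ContinuousOn (S.β1 k) (Set.pi Set.univ fun _ : Fin (k + 1) => Set.Icc 0 γ))
    {L : ℝ} (hL : 1 < L) (h : B12.Thm2Printed C L) : ∀ k, 0 ≤ S.β0 k :=
  beta0_nonneg_of_thm2Printed_fwd hgen S (remainderSmallAtZero_of_continuousOn_closedBox S hγ hcont) hL h

/-- (N1), `hgen` only, every-slope road. [cite: Balaban1987RG1, Thm 2 (0.31) p.259] -/
theorem beta0_nonneg_of_thm2Printed_fwd_everySlope {C : B12.Construction} (hgen : ForwardGenerated C β) (S : B12Beta.OneLoopSplit β)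
    {γc : ℝ} (hrem : EverySlope S γc) {L : ℝ} (hL : 1 < L) (h : B12.Thm2Printed C L) : ∀ k, 0 ≤ S.β0 k :=
  beta0_nonneg_of_thm2Printed_fwd hgen S
    (fun k ε hε => by
      obtain ⟨γ, hγ, -, hRC⟩ := hrem ε hε
      exact ⟨γ, hγ, fun p hp => hRC k p hp⟩) hL h

/-- (N1), `hgen` only, limit-form road. [cite: Balaban1987RG1, Thm 2 (0.31) p.259] -/
theorem beta0_nonneg_of_thm2Printed_fwd_limitForm (D : Beta.Assembly.LimitForm β) {C : B12.Construction}
    (hgen : ForwardGenerated C β) {L : ℝ} (hL : 1 < L) (h : B12.Thm2Printed C L) : ∀ k, 0 ≤ D.S.β0 k :=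
  beta0_nonneg_of_thm2Printed_fwd_everySlope hgen D.S (everySlope_of_af1 D.S D.γ₀_pos D.Cr_nonneg D.af1) hL h

/-- The NEGATIVE socket with `hgen` only: one `β⁰_{k+1} < 0` + near-zero control ⟹ ¬ Theorem 2 as typed, for every forward-generated construction.
[cite: Balaban1987RG1, Thm 2 (0.31) p.259] -/
theorem not_thm2Printed_of_beta0_neg_fwd {C : B12.Construction} (hgen : ForwardGenerated C β) (S : B12Beta.OneLoopSplit β)
    (hR : ∀ (k : ℕ) (ε : ℝ), 0 < ε → ∃ γ : ℝ, 0 < γ ∧ ∀ p ∈ B12Beta.HistBox γ k, |S.β1 k p| ≤ ε)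
    {k : ℕ} (hneg : S.β0 k < 0) {L : ℝ} (hL : 1 < L) : ¬ B12.Thm2Printed C L :=
  fun h => absurd (beta0_nonneg_of_thm2Printed_fwd hgen S hR hL h k) (not_le.mpr hneg)

/-! ## §3 (N2) and its consequences with forward generation only -/

/-- **(N2) PLUMBING WITH AN INEQUALITY RUN** (g1-plan-2 X-43 kernel): `CapSignsNecessary.beta0_windowSum_ge_of_run` with the window INEQUALITY
`1/g_{k'}² − 1/g_K² ≤ Σ_{[k',K)} β_j(prefix)` in place of `RGEqH`. [folklore] -/
theorem beta0_windowSum_ge_of_ineqRun (S : B12Beta.OneLoopSplit β) {K k N₀ : ℕ} {g : ℕ → ℝ} {gK c γ γs s R : ℝ} (hc : 0 < c)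
    (hwin : ∀ k', k' ≤ K → 1 / (g k') ^ 2 - 1 / (g K) ^ 2 ≤ ∑ j ∈ Finset.Ico k' K, β j (prefixOf g j))
    (hend : g K = gK) (hgK : 0 < gK) (hI : ∀ j, j ≤ K → 0 < g j ∧ g j ≤ γ)
    (hR : RemainderConst S γ R) (hs : RemainderConst S γs s) (hγs : 0 < γs) (hN₀ : 1 ≤ c * N₀ * γs ^ 2)
    (hlow : ∀ j, j ≤ K → 1 / gK ^ 2 + c * ((K : ℝ) - j) ≤ 1 / (g j) ^ 2) (hk : k ≤ K) :
    (c - s) * ((K : ℝ) - k) - R * N₀ ≤ ∑ j ∈ Finset.Ico k K, S.β0 j := by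
  have hgK2 : 0 < 1 / gK ^ 2 := by positivity
  have ht := hwin k hk
  rw [hend] at ht
  have hwin' : c * ((K : ℝ) - k) ≤ ∑ j ∈ Finset.Ico k K, β j (prefixOf g j) := by linarith [hlow k hk]
  set M : ℕ := max k (K - N₀) with hM
  have hkM : k ≤ M := le_max_left _ _
  have hMK : M ≤ K := max_le hk (Nat.sub_le K N₀)
  have hfar : ∀ j ∈ Finset.Ico k M, β j (prefixOf g j) ≤ S.β0 j + s := by
    intro j hj
    obtain ⟨hkj, hjM⟩ := Finset.mem_Ico.mp hj
    have hjK' : j < K - N₀ := by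
      rcases lt_max_iff.mp (hM ▸ hjM) with h | h
      · exact absurd hkj (not_le.mpr h)
      · exact h
    have hp : prefixOf g j ∈ B12Beta.HistBox γs j := by
      intro i
      have hiK : (i : ℕ) ≤ K := by omega
      have hgi := (hI i hiK).1
      refine ⟨by simpa [prefixOf_apply] using hgi, ?_⟩
      have hdist : (N₀ : ℝ) ≤ (K : ℝ) - (i : ℕ) := by
        have h1 : (i : ℕ) + N₀ < K := by omega
        have h2 : (((i : ℕ) + N₀ : ℕ) : ℝ) ≤ K := by exact_mod_cast h1.le
        push_cast at h2
        linarith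
      have h1 : c * N₀ ≤ 1 / (g i) ^ 2 := by
        have := hlow i hiK
        nlinarith [mul_le_mul_of_nonneg_left hdist hc.le]
      have hg2 : 0 < (g i) ^ 2 := by positivity
      have h2 : c * N₀ * (g i) ^ 2 ≤ 1 := by rwa [← le_div_iff₀ hg2]
      have h3 : (g i) ^ 2 ≤ γs ^ 2 := by nlinarith [hN₀, h2, hg2.le, sq_nonneg γs]
      have h4 : g i ≤ γs := (pow_le_pow_iff_left₀ hgi.le hγs.le two_ne_zero).mp h3
      simpa [prefixOf_apply] using h4
    have h1 := (abs_le.mp (hs j _ hp)).2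
    rw [S.split j]
    linarith
  have hnear : ∀ j ∈ Finset.Ico M K, β j (prefixOf g j) ≤ S.β0 j + R := by
    intro j hj
    have hjK : j ≤ K := (Finset.mem_Ico.mp hj).2.le
    have hp : prefixOf g j ∈ B12Beta.HistBox γ j := fun i => hI i (by omega)
    have h1 := (abs_le.mp (hR j _ hp)).2
    rw [S.split j]
    linarith
  have hs0 : 0 ≤ s := by
    have := hs 0 (fun _ => γs) (fun _ => ⟨hγs, le_rfl⟩)
    exact (abs_nonneg _).trans this
  have hR0 : 0 ≤ R := by
    have hγ0 : 0 < γ := (hI 0 (Nat.zero_le K)).1.trans_le (hI 0 (Nat.zero_le K)).2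
    have := hR 0 (fun _ => γ) (fun _ => ⟨hγ0, le_rfl⟩)
    exact (abs_nonneg _).trans this
  have hs1 := Finset.sum_le_sum hfar
  have hs2 := Finset.sum_le_sum hnear
  rw [Finset.sum_add_distrib, Finset.sum_const, Nat.card_Ico, nsmul_eq_mul] at hs1 hs2
  have hc1 : ((M - k : ℕ) : ℝ) ≤ (K : ℝ) - k := by
    rw [Nat.cast_sub hkM]
    have : (M : ℝ) ≤ K := by exact_mod_cast hMK
    linarith
  have hc2 : ((K - M : ℕ) : ℝ) ≤ N₀ := by exact_mod_cast (show K - M ≤ N₀ by omega)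
  have hsplitβ := Finset.sum_Ico_consecutive (fun j => β j (prefixOf g j)) hkM hMK
  have hsplit0 := Finset.sum_Ico_consecutive S.β0 hkM hMK
  nlinarith [hs1, hs2, hwin', hsplitβ, hsplit0, mul_le_mul_of_nonneg_right hc1 hs0, mul_le_mul_of_nonneg_right hc2 hR0]

/-- **(N2) WITH `hgen` ONLY, every-slope road**: `B12.Thm2Printed C L` (`L > 1`) for a forward-generated construction yields `c > 0`, `A` with
`c·n − A ≤ Σ_{j∈[k,k+n)} β⁰_{j+1}` for all `k, n`. [cite: Balaban1987RG1, Thm 2 (0.31) p.259] -/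
theorem beta0_windowSum_lower_of_thm2Printed_fwd {C : B12.Construction} (hgen : ForwardGenerated C β) (S : B12Beta.OneLoopSplit β)
    {γc : ℝ} (hrem : EverySlope S γc) {L : ℝ} (hL : 1 < L) (h : B12.Thm2Printed C L) :
    ∃ c : ℝ, 0 < c ∧ ∃ A : ℝ, ∀ k n : ℕ, c * n - A ≤ ∑ j ∈ Finset.Ico k (k + n), S.β0 j := by
  obtain ⟨γ₁, hγ₁, -, hR1⟩ := hrem 1 one_pos
  obtain ⟨γ₂, hγ₂, hγ⟩ := h 0
  obtain ⟨gstar, hgstar, hg⟩ := hγ (min γ₁ γ₂) (lt_min hγ₁ hγ₂) (min_le_right _ _)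
  obtain ⟨b, β', hb, -, hK⟩ := hg gstar hgstar le_rfl
  have hlog : 0 < Real.log L := Real.log_pos hL
  set c : ℝ := b * Real.log L with hc_def
  have hc : 0 < c := mul_pos hb hlog
  obtain ⟨γs, hγs, -, hs⟩ := hrem (c / 2) (by positivity)
  set N₀ : ℕ := ⌈1 / (c * γs ^ 2)⌉₊ with hN₀_def
  have hN₀ : 1 ≤ c * N₀ * γs ^ 2 := by
    have h1 : 1 / (c * γs ^ 2) ≤ N₀ := Nat.le_ceil _
    rw [div_le_iff₀ (by positivity)] at h1
    linarith
  have hR : RemainderConst S (min γ₁ γ₂) 1 := fun k p hp => hR1 k p fun i => ⟨(hp i).1, (hp i).2.trans (min_le_left _ _)⟩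
  refine ⟨c / 2, by positivity, 1 * N₀, fun k n => ?_⟩
  obtain ⟨g0, hI, hend, hbounds⟩ := hK (k + n)
  have hw := beta0_windowSum_ge_of_ineqRun S hc
    (fun k' hk' => windowSum_ge_of_forwardGenerated hgen ⟨k + n, 0, g0⟩ hI hk' le_rfl)
    hend hgstar hI hR hs hγs hN₀ (fun j hj => by have := (hbounds j hj).1; rw [hc_def]; linarith) (Nat.le_add_right k n)
  have e : (((k + n : ℕ) : ℝ) - k) = n := by push_cast; ring
  rw [e] at hw
  linarith

/-- The ABELIAN one-loop part refutes (0.31), `hgen` only. [cite: Balaban1987RG1, Thm 2 (0.31) p.259] -/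
theorem not_thm2Printed_of_abelian_fwd {C : B12.Construction} (hgen : ForwardGenerated C β) (S : B12Beta.OneLoopSplit β)
    {La : ℕ} (hLa : La ≠ 0) (hS : ∀ k, S.β0 k = ((Beta.Certified.abelianCoeff La k : ℚ) : ℝ)) {γc : ℝ} (hrem : EverySlope S γc)
    {L : ℝ} (hL : 1 < L) : ¬ B12.Thm2Printed C L := by
  intro h
  obtain ⟨c, hc, A, hw⟩ := beta0_windowSum_lower_of_thm2Printed_fwd hgen S hrem hL h
  refine not_partialSums_bounded_of_windowSum_lower hc hw (1 / 4) fun n => ?_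
  have hq : ∑ j ∈ Finset.range n, S.β0 j = ((∑ j ∈ Finset.range n, Beta.Certified.abelianCoeff La j : ℚ) : ℝ) := by
    rw [Rat.cast_sum]; exact Finset.sum_congr rfl fun j _ => hS j
  rw [hq, Beta.Certified.sum_range_abelianCoeff hLa n]
  push_cast
  have : 0 ≤ 1 / (La : ℝ) ^ (4 * n) := by positivity
  linarith

/-- Convergent one-loop coefficients: `0 < β⁰_∞` and an eventual floor, `hgen` only. [cite: Balaban1987RG1, Thm 2 (0.31) p.259] -/
theorem eventualFloor_of_thm2Printed_tendsto_fwd {C : B12.Construction} (hgen : ForwardGenerated C β) (S : B12Beta.OneLoopSplit β)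
    {γc : ℝ} (hrem : EverySlope S γc) {binf : ℝ} (hlim : Tendsto S.β0 atTop (𝓝 binf)) {L : ℝ} (hL : 1 < L)
    (h : B12.Thm2Printed C L) : 0 < binf ∧ ∃ k₀ : ℕ, ∀ k, k₀ ≤ k → binf / 2 ≤ S.β0 k := by
  obtain ⟨c, hc, A, hw⟩ := beta0_windowSum_lower_of_thm2Printed_fwd hgen S hrem hL h
  have hb : 0 < binf := hc.trans_le (le_lim_of_windowSum_lower_tendsto hw hlim)
  have hev : ∀ᶠ k in atTop, S.β0 k ∈ Set.Ioi (binf / 2) := hlim.eventually (Ioi_mem_nhds (by linarith))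
  obtain ⟨k₀, hk₀⟩ := eventually_atTop.mp hev
  exact ⟨hb, k₀, fun k hk => (Set.mem_Ioi.mp (hk₀ k hk)).le⟩

/-- **THE EXACT RESIDUE, hypothesis-symmetric**: on the limit-form road off the boundary, for every FORWARD-GENERATED construction (no halting,
no currying on EITHER side), `B12.Thm2Printed C L ↔ ∀ k < k₀, 0 < β⁰_{k+1}`. [cite: Balaban1987RG1, Thm 2 (0.31) p.259] -/
theorem thm2Printed_iff_signs_of_limitForm_fwd (D : Beta.Assembly.LimitForm β) {C : B12.Construction} (hgen : ForwardGenerated C β)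
    {L : ℝ} (hL : 1 < L) (hne : ∀ k, k < D.k₀ → D.S.β0 k ≠ 0) :
    B12.Thm2Printed C L ↔ ∀ k, k < D.k₀ → 0 < D.S.β0 k :=
  ⟨fun h k hk => lt_of_le_of_ne (beta0_nonneg_of_thm2Printed_fwd_limitForm D hgen hL h k) (hne k hk).symm,
    fun hsign => CapTailSigns.thm2Printed_of_signs D hgen hL hsign⟩

/-- The rate-free exact residue, hypothesis-symmetric (`hgen` only). [cite: Balaban1987RG1, Thm 2 (0.31) p.259] -/
theorem thm2Printed_iff_allSigns_and_limit_pos_fwd {C : B12.Construction} (hgen : ForwardGenerated C β) (S : B12Beta.OneLoopSplit β)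
    {γc β' binf : ℝ} (hlim : Tendsto S.β0 atTop (𝓝 binf)) (hrem : EverySlope S γc) (hcont : BetaContH γc β)
    (hup : BetaUpperH β' γc β) {L : ℝ} (hL : 1 < L) (hne : ∀ k, S.β0 k ≠ 0) :
    B12.Thm2Printed C L ↔ (∀ k, 0 < S.β0 k) ∧ 0 < binf :=
  ⟨fun h => ⟨fun k => lt_of_le_of_ne (beta0_nonneg_of_thm2Printed_fwd_everySlope hgen S hrem hL h k) (hne k).symm,
      (eventualFloor_of_thm2Printed_tendsto_fwd hgen S hrem hlim hL h).1⟩,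
    fun h => thm2Printed_of_allSigns_tendsto hgen hL S h.1 hlim h.2 hrem hcont hup⟩

/-! ## §4 The upper direction from forward generation + (U) (g1-plan-2 X-51) -/

/-- `BetaUpperH` is inherited by smaller boxes. [folklore] -/
theorem betaUpperH_of_le {β' γ γ' : ℝ} (h : BetaUpperH β' γ β) (hle : γ' ≤ γ) : BetaUpperH β' γ' β :=
  fun k v hv => h k v (mem_box.mpr fun i => ⟨(mem_box.mp hv i).1, (mem_box.mp hv i).2.trans hle⟩)

/-- `γ²β′ < 1` is inherited by smaller boxes (whatever the sign of `β′`). [folklore] -/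
theorem sq_mul_lt_one_of_le {β' γ γ' : ℝ} (h : γ ^ 2 * β' < 1) (hγ' : 0 ≤ γ') (hle : γ' ≤ γ) : γ' ^ 2 * β' < 1 := by
  by_cases hβ : 0 ≤ β'
  · exact lt_of_le_of_lt (mul_le_mul_of_nonneg_right (pow_le_pow_left₀ hγ' hle 2) hβ) h
  · have : γ' ^ 2 * β' ≤ 0 := mul_nonpos_of_nonneg_of_nonpos (sq_nonneg _) (not_le.mp hβ).le
    linarith

/-- **THE RUNS PACKAGE WITH THE HISTORY RECURSION FROM FORWARD GENERATION + (U)** — no `HaltsOutside`, no `CurriesHBeta`: same conclusion as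
`CapSignsNecessary.runs_of_thm2Printed` (boxes shrunk to `γ ≤ min γ₂ γU`), the identity from `T4TwoRunUniqueness.rgEqH_of_forwardGenerated` under
the printed upper bound `β_{k+1} ≤ β′U` on `]0,γU]`-boxes with `γU²β′U < 1`.  Adopted from g1-plan-2's X-51 kernel. [cite: Balaban1987RG1, Thm 2 (0.31) p.259; (0.20) p.256] -/
theorem runs_of_thm2Printed_fwdU {C : B12.Construction} {γU β'U L : ℝ} (hgen : ForwardGenerated C β) (hU : BetaUpperH β'U γU β)
    (hγU : 0 < γU) (hγβ : γU ^ 2 * β'U < 1) (h : B12.Thm2Printed C L) (m : ℕ) :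
    ∃ γ₂ : ℝ, 0 < γ₂ ∧ ∀ γ : ℝ, 0 < γ → γ ≤ γ₂ → ∃ gstar : ℝ, 0 < gstar ∧ ∀ g : ℝ, 0 < g → g ≤ gstar →
      ∃ b β' : ℝ, 0 < b ∧ b ≤ β' ∧ ∀ K : ℕ, ∃ g0 : ℝ,
        (C ⟨K, m, g0⟩).flow.InInterval γ K ∧ (C ⟨K, m, g0⟩).flow.g K = g ∧ RGEqH K β (C ⟨K, m, g0⟩).flow.g ∧
        ∀ k, k ≤ K →
          1 / g ^ 2 + b * (((K : ℝ) - k) * Real.log L) ≤ 1 / ((C ⟨K, m, g0⟩).flow.g k) ^ 2 ∧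
          1 / ((C ⟨K, m, g0⟩).flow.g k) ^ 2 ≤ 1 / g ^ 2 + β' * (((K : ℝ) - k) * Real.log L) := by
  obtain ⟨γ₂, hγ₂, hγ⟩ := h m
  refine ⟨min γ₂ γU, lt_min hγ₂ hγU, fun γ hγ0 hγle => ?_⟩
  obtain ⟨gstar, hgstar, hg⟩ := hγ γ hγ0 (hγle.trans (min_le_left _ _))
  refine ⟨gstar, hgstar, fun g hg0 hgle => ?_⟩
  obtain ⟨b, β', hb, hbβ', hK⟩ := hg g hg0 hgle
  refine ⟨b, β', hb, hbβ', fun K => ?_⟩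
  obtain ⟨g0, hI, hend, hbounds⟩ := hK K
  have hUγ : BetaUpperH β'U γ β := betaUpperH_of_le hU (hγle.trans (min_le_right _ _))
  have hγβ' : γ ^ 2 * β'U < 1 := sq_mul_lt_one_of_le hγβ hγ0.le (hγle.trans (min_le_right _ _))
  exact ⟨g0, hI, hend, T4TwoRunUniqueness.rgEqH_of_forwardGenerated C hgen hUγ hγβ' ⟨K, m, g0⟩ hI, hbounds⟩

/-- **THE SANDWICH FROM FORWARD GENERATION + (U)**: for a forward-generated construction obeying the printed upper bound (U) on some box
(`BetaUpperH β′U γU β`, `γU²β′U < 1`), with `EverySlope` and convergent `β⁰`, `B12.Thm2Printed C L` (`L > 1`) gives boxes on which (0.31) holds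
with SOME constants and EVERY pair realising it (with the recursion) satisfies `β·log L ≤ β⁰_∞ ≤ β′·log L`. [cite: Balaban1987RG1, Thm 2 (0.31) p.259] -/
theorem thm2Printed_constants_sandwich_fwdU {C : B12.Construction} {γU β'U : ℝ} (hgen : ForwardGenerated C β)
    (hU : BetaUpperH β'U γU β) (hγU : 0 < γU) (hγβ : γU ^ 2 * β'U < 1) (S : B12Beta.OneLoopSplit β) {γc binf : ℝ}
    (hrem : EverySlope S γc) (hlim : Tendsto S.β0 atTop (𝓝 binf)) {L : ℝ} (hL : 1 < L) (h : B12.Thm2Printed C L) (m : ℕ) :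
    ∃ γ₂ : ℝ, 0 < γ₂ ∧ ∀ γ : ℝ, 0 < γ → γ ≤ γ₂ → ∃ gstar : ℝ, 0 < gstar ∧ ∀ g : ℝ, 0 < g → g ≤ gstar →
      (∃ b β' : ℝ, 0 < b ∧ b ≤ β' ∧ ∀ K : ℕ, ∃ g0 : ℝ,
        (C ⟨K, m, g0⟩).flow.InInterval γ K ∧ (C ⟨K, m, g0⟩).flow.g K = g ∧ RGEqH K β (C ⟨K, m, g0⟩).flow.g ∧
        ∀ k, k ≤ K →
          1 / g ^ 2 + b * (((K : ℝ) - k) * Real.log L) ≤ 1 / ((C ⟨K, m, g0⟩).flow.g k) ^ 2 ∧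
          1 / ((C ⟨K, m, g0⟩).flow.g k) ^ 2 ≤ 1 / g ^ 2 + β' * (((K : ℝ) - k) * Real.log L)) ∧
      ∀ b β' : ℝ, 0 < b → (∀ K : ℕ, ∃ g0 : ℝ,
        (C ⟨K, m, g0⟩).flow.InInterval γ K ∧ (C ⟨K, m, g0⟩).flow.g K = g ∧ RGEqH K β (C ⟨K, m, g0⟩).flow.g ∧
        ∀ k, k ≤ K →
          1 / g ^ 2 + b * (((K : ℝ) - k) * Real.log L) ≤ 1 / ((C ⟨K, m, g0⟩).flow.g k) ^ 2 ∧
          1 / ((C ⟨K, m, g0⟩).flow.g k) ^ 2 ≤ 1 / g ^ 2 + β' * (((K : ℝ) - k) * Real.log L)) →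
        b * Real.log L ≤ binf ∧ binf ≤ β' * Real.log L := by
  obtain ⟨γ₁, hγ₁, -, hR1⟩ := hrem 1 one_pos
  obtain ⟨γ₂, hγ₂, hγ⟩ := runs_of_thm2Printed_fwdU hgen hU hγU hγβ h m
  refine ⟨min γ₁ γ₂, lt_min hγ₁ hγ₂, fun γ hγ0 hγle => ?_⟩
  obtain ⟨gstar, hgstar, hg⟩ := hγ γ hγ0 (hγle.trans (min_le_right _ _))
  have hR : RemainderConst S γ 1 := fun k p hp => hR1 k p fun i => ⟨(hp i).1, (hp i).2.trans (hγle.trans (min_le_left _ _))⟩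
  refine ⟨gstar, hgstar, fun g hg0 hgle => ⟨hg g hg0 hgle, fun b β' hb hK => ?_⟩⟩
  exact slope_sandwich_binf_of_runs S hg0 hb hL hR hrem hlim hK

/-! ## §5 On the datum `T4Continuum.FiniteEpsData` (fields `fwd`, `curries`; no halting field) -/

section Datum

variable {F : T4Continuum.T4Family} {G : Type*} [GaugeGroup G] [MeasurableSpace G] [HaarData G]

/-- **(N1) ON THE DATUM**: for `D : T4Continuum.FiniteEpsData F G` and a split `S` of `D.βfun` whose remainder is small near the zero history
scale-wise, `B12.Thm2Printed D.C.toB12 L` (`L > 1`) forces `0 ≤ β⁰_{k+1}` for every `k` (via `D.fwd`). [cite: Balaban1987RG1, Thm 2 (0.31) p.259] -/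
theorem beta0_nonneg_of_thm2Printed_datum (D : T4Continuum.FiniteEpsData F G) (S : B12Beta.OneLoopSplit D.βfun)
    (hR : ∀ (k : ℕ) (ε : ℝ), 0 < ε → ∃ γ : ℝ, 0 < γ ∧ ∀ p ∈ B12Beta.HistBox γ k, |S.β1 k p| ≤ ε)
    {L : ℝ} (hL : 1 < L) (h : B12.Thm2Printed D.C.toB12 L) : ∀ k, 0 ≤ S.β0 k :=
  beta0_nonneg_of_thm2Printed_fwd D.fwd S hR hL h

/-- **(N2) ON THE DATUM** (every-slope road). [cite: Balaban1987RG1, Thm 2 (0.31) p.259] -/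
theorem beta0_windowSum_lower_of_thm2Printed_datum (D : T4Continuum.FiniteEpsData F G) (S : B12Beta.OneLoopSplit D.βfun)
    {γc : ℝ} (hrem : EverySlope S γc) {L : ℝ} (hL : 1 < L) (h : B12.Thm2Printed D.C.toB12 L) :
    ∃ c : ℝ, 0 < c ∧ ∃ A : ℝ, ∀ k n : ℕ, c * n - A ≤ ∑ j ∈ Finset.Ico k (k + n), S.β0 j :=
  beta0_windowSum_lower_of_thm2Printed_fwd D.fwd S hrem hL h

/-- **THE EXACT RESIDUE ON THE DATUM** (limit-form road, off the boundary): `B12.Thm2Printed D.C.toB12 L ↔ ∀ k < k₀, 0 < β⁰_{k+1}`.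
[cite: Balaban1987RG1, Thm 2 (0.31) p.259] -/
theorem thm2Printed_iff_signs_of_limitForm_datum (D : T4Continuum.FiniteEpsData F G) (Lf : Beta.Assembly.LimitForm D.βfun)
    {L : ℝ} (hL : 1 < L) (hne : ∀ k, k < Lf.k₀ → Lf.S.β0 k ≠ 0) :
    B12.Thm2Printed D.C.toB12 L ↔ ∀ k, k < Lf.k₀ → 0 < Lf.S.β0 k :=
  thm2Printed_iff_signs_of_limitForm_fwd Lf D.fwd hL hne

/-- **THE SANDWICH ON THE DATUM** under (U) on a box. [cite: Balaban1987RG1, Thm 2 (0.31) p.259] -/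
theorem thm2Printed_constants_sandwich_datum (D : T4Continuum.FiniteEpsData F G) {γU β'U : ℝ}
    (hU : BetaUpperH β'U γU D.βfun) (hγU : 0 < γU) (hγβ : γU ^ 2 * β'U < 1) (S : B12Beta.OneLoopSplit D.βfun) {γc binf : ℝ}
    (hrem : EverySlope S γc) (hlim : Tendsto S.β0 atTop (𝓝 binf)) {L : ℝ} (hL : 1 < L) (h : B12.Thm2Printed D.C.toB12 L) (m : ℕ) :
    ∃ γ₂ : ℝ, 0 < γ₂ ∧ ∀ γ : ℝ, 0 < γ → γ ≤ γ₂ → ∃ gstar : ℝ, 0 < gstar ∧ ∀ g : ℝ, 0 < g → g ≤ gstar →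
      (∃ b β' : ℝ, 0 < b ∧ b ≤ β' ∧ ∀ K : ℕ, ∃ g0 : ℝ,
        (D.C.toB12 ⟨K, m, g0⟩).flow.InInterval γ K ∧ (D.C.toB12 ⟨K, m, g0⟩).flow.g K = g ∧
        RGEqH K D.βfun (D.C.toB12 ⟨K, m, g0⟩).flow.g ∧ ∀ k, k ≤ K →
          1 / g ^ 2 + b * (((K : ℝ) - k) * Real.log L) ≤ 1 / ((D.C.toB12 ⟨K, m, g0⟩).flow.g k) ^ 2 ∧
          1 / ((D.C.toB12 ⟨K, m, g0⟩).flow.g k) ^ 2 ≤ 1 / g ^ 2 + β' * (((K : ℝ) - k) * Real.log L)) ∧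
      ∀ b β' : ℝ, 0 < b → (∀ K : ℕ, ∃ g0 : ℝ,
        (D.C.toB12 ⟨K, m, g0⟩).flow.InInterval γ K ∧ (D.C.toB12 ⟨K, m, g0⟩).flow.g K = g ∧
        RGEqH K D.βfun (D.C.toB12 ⟨K, m, g0⟩).flow.g ∧ ∀ k, k ≤ K →
          1 / g ^ 2 + b * (((K : ℝ) - k) * Real.log L) ≤ 1 / ((D.C.toB12 ⟨K, m, g0⟩).flow.g k) ^ 2 ∧
          1 / ((D.C.toB12 ⟨K, m, g0⟩).flow.g k) ^ 2 ≤ 1 / g ^ 2 + β' * (((K : ℝ) - k) * Real.log L)) →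
        b * Real.log L ≤ binf ∧ binf ≤ β' * Real.log L :=
  thm2Printed_constants_sandwich_fwdU D.fwd hU hγU hγβ S hrem hlim hL h m

end Datum

end

end Summit.QuantumFields.BalabanUV.Gaps.CapSignsNecessaryFwd
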